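import Literature.GroupTheory.Index.DoubleCosetCardinality
import HarnessLib

/-!
# The index of `K ∩ tKt⁻¹` in `K` is the number of left cosets in `K t K ∕ K`
# ([ShimuraIATAF1971] §3.1, Prop. 3.1: `ΓαΓ = ⊔ᵢ Γαᵢ` with `d = [Γ : Γ ∩ α⁻¹Γα]` cosets; [DiamondShurman2005] §5.1, Lemma 5.1.2)

Topic `Literature/GroupTheory/Index`, namespace `Literature.GroupTheory.Index`; Mathlib + ★ `DoubleCosetCardinality` only, everything
proved (no definition, no named fact, no instance, no notation, no `sorry`).  Cell `hodgecm-mathlib` (D-0151), FLOOR 0, programme F0P5a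
(D9op road 2′, crux item stmt-HodgeConjecture-24832), row (b10) of F0P5a-plan (g3) (ED. 5.1 letter patch, 2026-08-31T04:16:42Z): the
pen `stub_C3_of` of `Cruxes/HLiu418/Lines/F0_D9opRoad2.lean` derives the full-fibre count `Nat.card (u′-fibre) = N w + 1` from the record
letter `RecordNeatLevelFullFibres` (which gives `K₁.1.1.relIndex Kc.1.1` for `K₁ = Kc ⊓ t₁Kct₁⁻¹`) and the ★ degree
`Nat.card ↥(orbit Kc (t₁ : _ ⧸ Kc)) = N w + 1` (p807687) — THIS file is the one-line bridge between the two currencies, for an ARBITRARY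
group `G`, subgroup `K` and element `t` (no finiteness: both sides are `0` when infinite):

* **`relIndex_inf_map_conj_eq_natCard_orbit K t : (K ⊓ K.map (MulAut.conj t).toMonoidHom).relIndex K = Nat.card ↥(orbit K (t : G ⧸ K))`**
  — orbit–stabiliser for the `K`-action on `G ∕ K` at the coset `tK`, whose stabiliser is `K ∩ tKt⁻¹` (★ `stabilizer_quotientMk_eq_subgroupOf`,
  Mathlib `MulAction.index_stabilizer`); i.e. the double coset `K t K` is the disjoint union of `[K : K ∩ tKt⁻¹]` left cosets `k t K`
  ([ShimuraIATAF1971] Prop. 3.1; [DiamondShurman2005] Lemma 5.1.2 with `Γ₁ = Γ₂ = K`, `Γ₃ = α⁻¹Γ₁α ∩ Γ₂`);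
* the `Set.ncard` spelling `relIndex_inf_map_conj_eq_ncard_orbit`, the symmetric spelling `relIndex_map_conj_inf_eq_natCard_orbit`
  (`(tKt⁻¹ ⊓ K).relIndex K`), and the plain `tKt⁻¹` spelling `relIndex_map_conj_eq_natCard_orbit` (`(tKt⁻¹).relIndex K`);
* the consumer form `relIndex_eq_natCard_orbit_of_eq_inf_map_conj (hK₁ : K₁ = K ⊓ K.map (MulAut.conj t).toMonoidHom) :
  K₁.relIndex K = Nat.card ↥(orbit K (t : G ⧸ K))` (the shape `_hK₁` in which the D9op letters prescribe the level `K₁`).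

HC_CM is proved only modulo the 7 printed citations until rung 0 closes; this file is a generic leaf and changes no count.

## References
* [ShimuraIATAF1971] G. Shimura, *Introduction to the Arithmetic Theory of Automorphic Functions*, Princeton UP (1971), §3.1,
  Prop. 3.1 (the double coset `ΓαΓ` is a disjoint union of `d = [Γ : Γ ∩ α⁻¹Γα]` cosets `Γαᵢ`).
* [DiamondShurman2005] F. Diamond, J. Shurman, *A First Course in Modular Forms*, GTM 228 (2005), §5.1, Lemma 5.1.2 (orbit space
  `Γ₃ ∖ Γ₂ ≃` the cosets `Γ₁ βⱼ` of `Γ₁αΓ₂`, `Γ₃ = α⁻¹Γ₁α ∩ Γ₂`).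
* [MccoyJanusz2001] N. H. McCoy, G. J. Janusz, *Introduction to Abstract Algebra*, 6th ed. (2001), Ch. II §5 Ex. 12 (b), p. 167 (the
  stabiliser of `aK` in `H` is `H ∩ aKa⁻¹`; ★ `DoubleCosetCardinality`).
-/

open MulAction
open scoped Pointwise

namespace Literature.GroupTheory.Index

variable {G : Type*} [Group G] (K : Subgroup G) (t : G)

/-- **`[K : K ∩ tKt⁻¹] = #(K t K ∕ K)`**: the relative index of `K ⊓ tKt⁻¹` in `K` is the number of left `K`-cosets in the `K`-orbit of `tK`
in `G ∕ K` (orbit–stabiliser; the stabiliser of `tK` in `K` is `K ∩ tKt⁻¹`).  `Nat.card` form, no finiteness needed (both sides vanish when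
infinite). [cite: ShimuraIATAF1971, §3.1 Prop. 3.1] [cite: DiamondShurman2005, §5.1 Lemma 5.1.2] -/
theorem relIndex_inf_map_conj_eq_natCard_orbit :
    (K ⊓ K.map (MulAut.conj t).toMonoidHom).relIndex K = Nat.card (orbit K (t : G ⧸ K)) := by
  rw [Subgroup.relIndex, Subgroup.inf_subgroupOf_left, ← stabilizer_quotientMk_eq_subgroupOf K K t,
    MulAction.index_stabilizer, Nat.card_coe_set_eq]

/-- The `Set.ncard` spelling: `[K : K ∩ tKt⁻¹] = (K·(tK)).ncard`. [cite: ShimuraIATAF1971, §3.1 Prop. 3.1] [cite: DiamondShurman2005, §5.1 Lemma 5.1.2] -/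
theorem relIndex_inf_map_conj_eq_ncard_orbit :
    (K ⊓ K.map (MulAut.conj t).toMonoidHom).relIndex K = (orbit K (t : G ⧸ K)).ncard := by
  rw [relIndex_inf_map_conj_eq_natCard_orbit, Nat.card_coe_set_eq]

/-- The symmetric spelling `(tKt⁻¹ ⊓ K).relIndex K = #(K t K ∕ K)`. [cite: ShimuraIATAF1971, §3.1 Prop. 3.1] [cite: DiamondShurman2005, §5.1 Lemma 5.1.2] -/
theorem relIndex_map_conj_inf_eq_natCard_orbit :
    (K.map (MulAut.conj t).toMonoidHom ⊓ K).relIndex K = Nat.card (orbit K (t : G ⧸ K)) := by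
  rw [inf_comm, relIndex_inf_map_conj_eq_natCard_orbit]

/-- The plain spelling `(tKt⁻¹).relIndex K = #(K t K ∕ K)` (Mathlib's `relIndex` already intersects with `K`).
[cite: ShimuraIATAF1971, §3.1 Prop. 3.1] [cite: DiamondShurman2005, §5.1 Lemma 5.1.2] -/
theorem relIndex_map_conj_eq_natCard_orbit :
    (K.map (MulAut.conj t).toMonoidHom).relIndex K = Nat.card (orbit K (t : G ⧸ K)) := by
  rw [← Subgroup.inf_relIndex_right, relIndex_map_conj_inf_eq_natCard_orbit]

/-- **Consumer form**: for any subgroup `K₁` PRESCRIBED as `K ⊓ tKt⁻¹` (the shape `_hK₁ : K₁ = K ⊓ K.map (MulAut.conj t).toMonoidHom` in which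
the level of the Hecke correspondence `T(t)` is quantified), `K₁.relIndex K = #(K t K ∕ K)`. [cite: ShimuraIATAF1971, §3.1 Prop. 3.1]
[cite: DiamondShurman2005, §5.1 Lemma 5.1.2] -/
theorem relIndex_eq_natCard_orbit_of_eq_inf_map_conj {K K₁ : Subgroup G} {t : G}
    (hK₁ : K₁ = K ⊓ K.map (MulAut.conj t).toMonoidHom) :
    K₁.relIndex K = Nat.card (orbit K (t : G ⧸ K)) := by
  rw [hK₁, relIndex_inf_map_conj_eq_natCard_orbit]

/-- Orbit–stabiliser at `tK` in index form: `#(K t K ∕ K) · |K ∩ tKt⁻¹| = |K|` (`Nat.card`, no finiteness) — ★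
`natCard_orbit_mul_natCard_stabilizer` with the stabiliser identified. [cite: MccoyJanusz2001, Ch. II §5 Exercise 12 (b), p. 167]
[cite: ShimuraIATAF1971, §3.1 Prop. 3.1] -/
theorem natCard_orbit_mul_natCard_inf_map_conj :
    Nat.card (orbit K (t : G ⧸ K)) * Nat.card (K ⊓ K.map (MulAut.conj t).toMonoidHom : Subgroup G) = Nat.card K := by
  rw [← natCard_stabilizer_quotientMk K K t, natCard_orbit_mul_natCard_stabilizer]

end Literature.GroupTheory.Index
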